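import Summits.NavierStokesRegularity.FluidComputer.EulerRateInequality
import Summits.NavierStokesRegularity.FluidComputer.StraddleInterpolation
import HarnessLib

/-!
# Fluid computer — support: the ν-FREE, ENERGY-FREE Riccati law of the straddling pairs
# `Z_λ = Y_{5−δ} + λ Y_{5+δ}`: `Z_λ(t) − Z_λ(s) ≤ K_δ λ^{−1/4} ∫_s^t Z_λ^{3/2}` for EVERY `λ > 0`

HONEST FRAMING (cell `pub-fluidc`, verbatim): *low prior, high value-of-information experiment on Tao's
machine paradigm; NOT a claim that NS blows up.* Support file. Along every maximal smooth solution `(u, p)` of the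
unforced Navier–Stokes system on `ℝ³ × [0, T)` (`ν > 0`) which is Leray–Hopf from `u 0`, with
`Y_κ(τ) = ∑_j 2^{κj} ‖Δ̇_j u(τ)‖₂²` and a fixed `δ ∈ (0, 4]`:

* `window_le_row_mul_lipschitzRow` — one slice, one weight `κ ≥ 1`: `∑_{j∈I} 2^{κj}(−νS_j − N_j) ≤ (A_κ Y_κ R)` (real
  numbers; `R = ∑_l 2^l ‖Δ̇_l w‖_∞`, dissipation dropped, `LipschitzSummation.transfer_row_le_lipschitz`);
* `rpow_quarter_le` — `(x y)^{1/4} ≤ λ^{−1/4} (x + λ y)^{1/2}` for `x, y ≥ 0`, `λ > 0`;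
* `straddle_slice_le` — ONE SLICE: for every `λ > 0`, `∑_{j∈I} (2^{(5−δ)j} + λ 2^{(5+δ)j})(−νS_j − N_j) ≤
  K_δ λ^{−1/4} (Y_{5−δ} + λ Y_{5+δ})^{3/2}`, `K_δ` INDEPENDENT of `λ`, of `ν` and of the energy (the Lipschitz row through
  the `Ḃ^{5/2}_{2,1}` row, `StraddleInterpolation.lipRow_pow_four_le`, then `(Y₋Y₊)^{1/4} ≤ λ^{−1/4} Z_λ^{1/2}`);
* `straddle_two_point` (**THE RICCATI LAW OF THE STRADDLING PAIRS, integrated**) —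
  `Z_λ(t) − Z_λ(s) ≤ K λ^{−1/4} ∫_s^t Z_λ(τ)^{3/2} dτ` for all `0 < s ≤ t < T` and EVERY `λ > 0`: the family of sums
  `Y_{5−δ} + λY_{5+δ}` obeys the scaling-critical law `z' ≲ λ^{−1/4} z^{3/2}` uniformly in `λ` — optimising `λ` at an instant
  (successor file) gives the rate-OPTIMAL inviscid clock `Y_{5−δ}(t) Y_{5+δ}(t) ≳ (T − t)^{−4}`.

0 sorry; no definitions; no named facts.

## References

* J. C. Robinson, W. Sadowski, R. P. Silva, J. Math. Phys. 53 (2012) 115618, §III (3.6), §V.A. [RobinsonSadowskiSilva2012]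
* H. Bahouri, J.-Y. Chemin, R. Danchin, Grundlehren 343 (2011), Lemma 2.100, Prop. 2.22. [BahouriCheminDanchin2011]
-/

noncomputable section

open MeasureTheory Set Function Filter Topology
open scoped ENNReal NNReal RealInnerProductSpace
open Literature.Analysis.FluidPDE Literature.Analysis.FunctionSpaces
open Summit.NavierStokesRegularity.FluidComputer.BlockEnergyTransport
open Summit.NavierStokesRegularity.FluidComputer.BlockEnergyIdentity
open Summit.NavierStokesRegularity.FluidComputer.LipschitzSummation
open Summit.NavierStokesRegularity.FluidComputer.EulerRateInequality
open Summit.NavierStokesRegularity.FluidComputer.StraddleInterpolation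

namespace Summit.NavierStokesRegularity.FluidComputer.StraddleInequality

/-! ## One slice, one weight: the window against `Y_κ · R` -/

/-- **One slice at one weight `κ ≥ 1`**: there is a finite `A = A_κ` such that for every `ν ≥ 0`, every smooth
divergence-free `L²` field `w` on `ℝ³` with finite `κ`-row `Y_κ` and finite Lipschitz row `R = ∑_l 2^l ‖Δ̇_l w‖_∞`, and
every finite set of levels `I`: `∑_{j∈I} 2^{κj}(−ν S_j − N_j) ≤ (A · Y_κ · R)` (real numbers; `−νS_j ≤ 0`, `−N_j ≤ |N_j|`,
`LipschitzSummation.transfer_row_le_lipschitz`). [cite: RobinsonSadowskiSilva2012, §III (3.6)] -/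
theorem window_le_row_mul_lipschitzRow {κ : ℝ} (hκ1 : 1 ≤ κ) :
    ∃ A : ℝ≥0∞, A ≠ ∞ ∧ ∀ (ν : ℝ), 0 ≤ ν →
      ∀ (w : EuclideanSpace ℝ (Fin 3) → EuclideanSpace ℝ (Fin 3)), IsSmoothL2Field w → VectorCalculus.IsDivFree w →
      ∑' j : ℤ, (2 : ℝ≥0∞) ^ (κ * (j : ℝ)) * blockL2 w j ^ 2 ≠ ∞ →
      ∑' l : ℤ, (2 : ℝ≥0∞) ^ l * blockSup w l ≠ ∞ → ∀ I : Finset ℤ,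
        ∑ j ∈ I, ((2 : ℝ≥0∞) ^ (κ * (j : ℝ))).toReal *
            (-ν * (∑ i, ∫ x, ‖fderiv ℝ (blockFn j w) x (stdOrthonormalBasis ℝ (EuclideanSpace ℝ (Fin 3)) i)‖ ^ 2) -
              ∫ x, ⟪blockFn j w x, blockFn j (convect w w) x⟫) ≤
          (A * (∑' j : ℤ, (2 : ℝ≥0∞) ^ (κ * (j : ℝ)) * blockL2 w j ^ 2) *
            ∑' l : ℤ, (2 : ℝ≥0∞) ^ l * blockSup w l).toReal := by
  obtain ⟨A, hAtop, hA⟩ := transfer_row_le_lipschitz (κ := κ) hκ1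
  refine ⟨A, hAtop, fun ν hν w hw hdiv hY hR I => ?_⟩
  set W : ℤ → ℝ≥0∞ := fun j => (2 : ℝ≥0∞) ^ (κ * (j : ℝ)) with hW
  set S : ℤ → ℝ := fun j => ∑ i, ∫ x, ‖fderiv ℝ (blockFn j w) x (stdOrthonormalBasis ℝ (EuclideanSpace ℝ (Fin 3)) i)‖ ^ 2
    with hS
  set N : ℤ → ℝ := fun j => ∫ x, ⟪blockFn j w x, blockFn j (convect w w) x⟫ with hN
  have hWtop : ∀ j, W j ≠ ∞ := fun j => RiccatiSlice.two_rpow_ne_top _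
  have hS0 : ∀ j, 0 ≤ S j := fun j => Finset.sum_nonneg fun i _ => integral_nonneg fun x => sq_nonneg _
  have h1 : ∑ j ∈ I, (W j).toReal * (-ν * S j - N j) ≤ ∑ j ∈ I, (W j * ‖N j‖ₑ).toReal := by
    refine Finset.sum_le_sum fun j _ => ?_
    rw [ENNReal.toReal_mul, Real.enorm_eq_ofReal_abs, ENNReal.toReal_ofReal (abs_nonneg _)]
    refine mul_le_mul_of_nonneg_left ?_ ENNReal.toReal_nonneg
    have h := hS0 j
    have hNabs : -N j ≤ |N j| := neg_le_abs _
    nlinarith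
  refine h1.trans ?_
  rw [← ENNReal.toReal_sum fun j _ => ENNReal.mul_ne_top (hWtop j) (by
    rw [Real.enorm_eq_ofReal_abs]; exact ENNReal.ofReal_ne_top)]
  refine ENNReal.toReal_mono (ENNReal.mul_ne_top (ENNReal.mul_ne_top hAtop hY) hR) ?_
  exact (ENNReal.sum_le_tsum I).trans (hA w hw hdiv)

/-! ## An elementary mean inequality -/

/-- `(x y)^{1/4} ≤ λ^{−1/4} (x + λ y)^{1/2}` for `x, y ≥ 0` and `λ > 0` (`x·λy ≤ (x + λy)²`). [folklore] -/
theorem rpow_quarter_le {x y lam : ℝ} (hx : 0 ≤ x) (hy : 0 ≤ y) (hlam : 0 < lam) :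
    (x * y) ^ (1 / 4 : ℝ) ≤ lam ^ (-(1 / 4 : ℝ)) * (x + lam * y) ^ (1 / 2 : ℝ) := by
  have hly : 0 ≤ lam * y := by positivity
  have h1 : x * (lam * y) ≤ (x + lam * y) ^ 2 := by nlinarith [mul_nonneg hx hly]
  have h2 : (x * (lam * y)) ^ (1 / 4 : ℝ) ≤ ((x + lam * y) ^ 2) ^ (1 / 4 : ℝ) :=
    Real.rpow_le_rpow (by positivity) h1 (by norm_num)
  have h3 : ((x + lam * y) ^ 2) ^ (1 / 4 : ℝ) = (x + lam * y) ^ (1 / 2 : ℝ) := by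
    rw [← Real.rpow_natCast, ← Real.rpow_mul (by positivity)]; norm_num
  have h4 : (x * (lam * y)) ^ (1 / 4 : ℝ) = lam ^ (1 / 4 : ℝ) * (x * y) ^ (1 / 4 : ℝ) := by
    rw [show x * (lam * y) = lam * (x * y) by ring, Real.mul_rpow hlam.le (by positivity)]
  rw [h3, h4] at h2
  have hl4 : 0 < lam ^ (1 / 4 : ℝ) := Real.rpow_pos_of_pos hlam _
  rw [Real.rpow_neg hlam.le, ← div_eq_inv_mul, le_div_iff₀ hl4]
  linarith

/-! ## One slice: the straddling pair -/

/-- **THE ν-FREE, ENERGY-FREE RICCATI INTEGRAND OF A STRADDLING PAIR (one time slice).** For every `δ ∈ (0, 4]` there is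
`K₁ = K₁(δ) > 0` such that for every `ν ≥ 0`, every `λ > 0`, every smooth divergence-free `L²` field `w` on `ℝ³` whose rows
`Y₋ = ∑_j 2^{(5−δ)j}‖Δ̇_j w‖₂²`, `Y₊ = ∑_j 2^{(5+δ)j}‖Δ̇_j w‖₂²` are finite, and every finite set of levels `I`:
`∑_{j∈I} (2^{(5−δ)j} + λ 2^{(5+δ)j}) (−ν S_j − N_j) ≤ K₁ · λ^{−1/4} · (Y₋ + λ Y₊)^{3/2}` (real numbers) — both windows are
`≤ A_± Y_± R`, `R ≤ C_B ∑2^{5l/2}a_l ≤ C_B C_δ^{1/4}(Y₋Y₊)^{1/4} ≤ C_B C_δ^{1/4} λ^{−1/4}(Y₋ + λY₊)^{1/2}`.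
[cite: RobinsonSadowskiSilva2012, §III (3.6), §V.A] [cite: BahouriCheminDanchin2011, Lemma 2.100, Prop. 2.22] -/
theorem straddle_slice_le {δ : ℝ} (hδ : 0 < δ) (hδ4 : δ ≤ 4) :
    ∃ K₁ : ℝ, 0 < K₁ ∧ ∀ (ν : ℝ), 0 ≤ ν → ∀ (lam : ℝ), 0 < lam →
      ∀ (w : EuclideanSpace ℝ (Fin 3) → EuclideanSpace ℝ (Fin 3)), IsSmoothL2Field w → VectorCalculus.IsDivFree w →
      ∑' j : ℤ, (2 : ℝ≥0∞) ^ ((5 - δ) * (j : ℝ)) * blockL2 w j ^ 2 ≠ ∞ →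
      ∑' j : ℤ, (2 : ℝ≥0∞) ^ ((5 + δ) * (j : ℝ)) * blockL2 w j ^ 2 ≠ ∞ → ∀ I : Finset ℤ,
        ∑ j ∈ I, (((2 : ℝ≥0∞) ^ ((5 - δ) * (j : ℝ))).toReal + lam * ((2 : ℝ≥0∞) ^ ((5 + δ) * (j : ℝ))).toReal) *
            (-ν * (∑ i, ∫ x, ‖fderiv ℝ (blockFn j w) x (stdOrthonormalBasis ℝ (EuclideanSpace ℝ (Fin 3)) i)‖ ^ 2) -
              ∫ x, ⟪blockFn j w x, blockFn j (convect w w) x⟫) ≤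
          K₁ * lam ^ (-(1 / 4 : ℝ)) *
            ((∑' j : ℤ, (2 : ℝ≥0∞) ^ ((5 - δ) * (j : ℝ)) * blockL2 w j ^ 2).toReal +
              lam * (∑' j : ℤ, (2 : ℝ≥0∞) ^ ((5 + δ) * (j : ℝ)) * blockL2 w j ^ 2).toReal) ^ (3 / 2 : ℝ) := by
  obtain ⟨Am, hAmtop, hAm⟩ := window_le_row_mul_lipschitzRow (κ := 5 - δ) (by linarith)
  obtain ⟨Ap, hAptop, hAp⟩ := window_le_row_mul_lipschitzRow (κ := 5 + δ) (by linarith)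
  obtain ⟨CB, hCB⟩ := lipschitzRow_le_lipRow
  obtain ⟨C, hC, hint⟩ := lipRow_pow_four_le hδ
  refine ⟨(Am.toReal + Ap.toReal) * CB * C ^ (1 / 4 : ℝ) + 1, by positivity, fun ν hν lam hlam w hw hdiv hYm hYp I => ?_⟩
  set Wm : ℤ → ℝ≥0∞ := fun j => (2 : ℝ≥0∞) ^ ((5 - δ) * (j : ℝ)) with hWm
  set Wp : ℤ → ℝ≥0∞ := fun j => (2 : ℝ≥0∞) ^ ((5 + δ) * (j : ℝ)) with hWp
  set Ym : ℝ≥0∞ := ∑' j : ℤ, Wm j * blockL2 w j ^ 2 with hYmdef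
  set Yp : ℝ≥0∞ := ∑' j : ℤ, Wp j * blockL2 w j ^ 2 with hYpdef
  set g : ℤ → ℝ := fun j =>
    -ν * (∑ i, ∫ x, ‖fderiv ℝ (blockFn j w) x (stdOrthonormalBasis ℝ (EuclideanSpace ℝ (Fin 3)) i)‖ ^ 2) -
      ∫ x, ⟪blockFn j w x, blockFn j (convect w w) x⟫ with hg
  set P : ℝ≥0∞ := ∑' l : ℤ, (2 : ℝ≥0∞) ^ ((5 / 2 : ℝ) * (l : ℝ)) * blockL2 w l with hP
  set R : ℝ≥0∞ := ∑' l : ℤ, (2 : ℝ≥0∞) ^ l * blockSup w l with hR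
  have hw2 : MemLp w 2 volume := hw.memLp_two
  have hPtop : P ≠ ∞ := lipRow_ne_top_of_straddle w hδ hYm hYp
  have hRP : R ≤ CB * P := hCB w hw2
  have hRtop : R ≠ ∞ := ne_top_of_le_ne_top (ENNReal.mul_ne_top ENNReal.coe_ne_top hPtop) hRP
  set Z : ℝ := Ym.toReal + lam * Yp.toReal with hZ
  have hYm0 : 0 ≤ Ym.toReal := ENNReal.toReal_nonneg
  have hYp0 : 0 ≤ Yp.toReal := ENNReal.toReal_nonneg
  have hZ0 : 0 ≤ Z := by rw [hZ]; positivity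
  -- the two windows
  have hsplit : ∑ j ∈ I, ((Wm j).toReal + lam * (Wp j).toReal) * g j =
      (∑ j ∈ I, (Wm j).toReal * g j) + lam * ∑ j ∈ I, (Wp j).toReal * g j := by
    rw [Finset.mul_sum, ← Finset.sum_add_distrib]
    exact Finset.sum_congr rfl fun j _ => by ring
  have hm := hAm ν hν w hw hdiv hYm hRtop I
  have hp := hAp ν hν w hw hdiv hYp hRtop I
  rw [ENNReal.toReal_mul, ENNReal.toReal_mul] at hm hp
  -- the Lipschitz row through `(Y₋Y₊)^{1/4}`
  have hR' : R.toReal ≤ CB * C ^ (1 / 4 : ℝ) * lam ^ (-(1 / 4 : ℝ)) * Z ^ (1 / 2 : ℝ) := by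
    have h1 : R.toReal ≤ CB * P.toReal := by
      have := ENNReal.toReal_mono (ENNReal.mul_ne_top ENNReal.coe_ne_top hPtop) hRP
      rwa [ENNReal.toReal_mul, ENNReal.coe_toReal] at this
    have h2 : P.toReal ^ (4 : ℝ) ≤ C * Ym.toReal * Yp.toReal := hint w hYm hYp
    have h3 : P.toReal ≤ (C * Ym.toReal * Yp.toReal) ^ (1 / 4 : ℝ) := by
      have h := Real.rpow_le_rpow (by positivity) h2 (by norm_num : (0 : ℝ) ≤ 1 / 4)
      rwa [← Real.rpow_mul ENNReal.toReal_nonneg, show (4 : ℝ) * (1 / 4) = 1 by norm_num, Real.rpow_one] at h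
    have h4 : (C * Ym.toReal * Yp.toReal) ^ (1 / 4 : ℝ) = C ^ (1 / 4 : ℝ) * (Ym.toReal * Yp.toReal) ^ (1 / 4 : ℝ) := by
      rw [mul_assoc, Real.mul_rpow hC.le (by positivity)]
    have h5 := rpow_quarter_le hYm0 hYp0 hlam
    calc R.toReal ≤ CB * P.toReal := h1
      _ ≤ CB * (C ^ (1 / 4 : ℝ) * (Ym.toReal * Yp.toReal) ^ (1 / 4 : ℝ)) := by
          rw [← h4]; exact mul_le_mul_of_nonneg_left h3 (NNReal.coe_nonneg _)
      _ ≤ CB * (C ^ (1 / 4 : ℝ) * (lam ^ (-(1 / 4 : ℝ)) * Z ^ (1 / 2 : ℝ))) := by gcongr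
      _ = _ := by ring
  -- assemble
  have hAm0 : 0 ≤ Am.toReal := ENNReal.toReal_nonneg
  have hAp0 : 0 ≤ Ap.toReal := ENNReal.toReal_nonneg
  have hR0 : 0 ≤ R.toReal := ENNReal.toReal_nonneg
  have hsum : (∑ j ∈ I, (Wm j).toReal * g j) + lam * ∑ j ∈ I, (Wp j).toReal * g j ≤
      (Am.toReal + Ap.toReal) * Z * R.toReal := by
    have e1 : Am.toReal * Ym.toReal * R.toReal + lam * (Ap.toReal * Yp.toReal * R.toReal) ≤
        (Am.toReal + Ap.toReal) * Z * R.toReal := by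
      rw [hZ]
      nlinarith [mul_nonneg (mul_nonneg hAp0 hYm0) hR0, mul_nonneg (mul_nonneg hAm0 (mul_nonneg hlam.le hYp0)) hR0]
    exact (add_le_add hm (mul_le_mul_of_nonneg_left hp hlam.le)).trans e1
  have hZ32 : Z * Z ^ (1 / 2 : ℝ) = Z ^ (3 / 2 : ℝ) := by
    rw [show (3 / 2 : ℝ) = 1 + 1 / 2 by norm_num, Real.rpow_add' hZ0 (by norm_num), Real.rpow_one]
  rw [hsplit]
  calc (∑ j ∈ I, (Wm j).toReal * g j) + lam * ∑ j ∈ I, (Wp j).toReal * g j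
      ≤ (Am.toReal + Ap.toReal) * Z * R.toReal := hsum
    _ ≤ (Am.toReal + Ap.toReal) * Z * (CB * C ^ (1 / 4 : ℝ) * lam ^ (-(1 / 4 : ℝ)) * Z ^ (1 / 2 : ℝ)) := by
        gcongr
    _ = ((Am.toReal + Ap.toReal) * CB * C ^ (1 / 4 : ℝ)) * lam ^ (-(1 / 4 : ℝ)) * (Z * Z ^ (1 / 2 : ℝ)) := by ring
    _ ≤ ((Am.toReal + Ap.toReal) * CB * C ^ (1 / 4 : ℝ) + 1) * lam ^ (-(1 / 4 : ℝ)) * (Z * Z ^ (1 / 2 : ℝ)) := by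
        gcongr
        linarith
    _ = _ := by rw [hZ32]

/-! ## The integrated Riccati law of the straddling pairs -/

/-- **THE ν-FREE, ENERGY-FREE RICCATI LAW OF THE STRADDLING PAIRS, integrated (`δ ∈ (0, 4]`).** There is
`K = K_δ > 0` such that for every `ν > 0`, `T > 0`, every maximal smooth solution `(u, p)` of the unforced Navier–Stokes
system on `ℝ³ × [0, T)` which is Leray–Hopf from `u 0`, EVERY `λ > 0` and all `0 < s ≤ t < T`:
`Z_λ(t) − Z_λ(s) ≤ K λ^{−1/4} ∫_s^t Z_λ(τ)^{3/2} dτ`, `Z_λ(τ) = Y_{5−δ}(τ) + λ Y_{5+δ}(τ)`, `Y_κ(τ) = ∑_j 2^{κj}‖Δ̇_j u(τ)‖₂²`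
— the signed block balances × `(2^{(5−δ)j} + λ2^{(5+δ)j})` summed over `|j| ≤ L`, `straddle_slice_le` on each slice,
integration (`Y_±` continuous, `HighRows.continuousOn_row`), `L → ∞`. No `ν`, no energy, `K` uniform in `λ`.
[cite: RobinsonSadowskiSilva2012, §V.A] -/
theorem straddle_two_point {δ : ℝ} (hδ : 0 < δ) (hδ4 : δ ≤ 4) :
    ∃ K : ℝ, 0 < K ∧ ∀ (ν T : ℝ), 0 < ν → 0 < T →
      ∀ (u : ℝ → EuclideanSpace ℝ (Fin 3) → EuclideanSpace ℝ (Fin 3)) (p : ℝ → EuclideanSpace ℝ (Fin 3) → ℝ),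
      IsMaximalSmoothSolution ν 0 u p T → IsLerayHopfOn T ν 0 (u 0) u →
      ∀ (lam : ℝ), 0 < lam → ∀ s t : ℝ, 0 < s → s ≤ t → t < T →
        ((∑' j : ℤ, (2 : ℝ≥0∞) ^ ((5 - δ) * (j : ℝ)) * blockL2 (u t) j ^ 2).toReal +
            lam * (∑' j : ℤ, (2 : ℝ≥0∞) ^ ((5 + δ) * (j : ℝ)) * blockL2 (u t) j ^ 2).toReal) -
          ((∑' j : ℤ, (2 : ℝ≥0∞) ^ ((5 - δ) * (j : ℝ)) * blockL2 (u s) j ^ 2).toReal +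
            lam * (∑' j : ℤ, (2 : ℝ≥0∞) ^ ((5 + δ) * (j : ℝ)) * blockL2 (u s) j ^ 2).toReal) ≤
          K * lam ^ (-(1 / 4 : ℝ)) *
            ∫ τ in s..t, ((∑' j : ℤ, (2 : ℝ≥0∞) ^ ((5 - δ) * (j : ℝ)) * blockL2 (u τ) j ^ 2).toReal +
              lam * (∑' j : ℤ, (2 : ℝ≥0∞) ^ ((5 + δ) * (j : ℝ)) * blockL2 (u τ) j ^ 2).toReal) ^ (3 / 2 : ℝ) := by
  obtain ⟨K₁, hK₁, hslice⟩ := straddle_slice_le hδ hδ4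
  refine ⟨2 * K₁, by positivity, fun ν T hν hT u p hmax hLH lam hlam s t hs hst htT => ?_⟩
  set Wm : ℤ → ℝ≥0∞ := fun j => (2 : ℝ≥0∞) ^ ((5 - δ) * (j : ℝ)) with hWm
  set Wp : ℤ → ℝ≥0∞ := fun j => (2 : ℝ≥0∞) ^ ((5 + δ) * (j : ℝ)) with hWp
  set Ym : ℝ → ℝ := fun τ => (∑' j : ℤ, Wm j * blockL2 (u τ) j ^ 2).toReal with hYm
  set Yp : ℝ → ℝ := fun τ => (∑' j : ℤ, Wp j * blockL2 (u τ) j ^ 2).toReal with hYp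
  set Z : ℝ → ℝ := fun τ => Ym τ + lam * Yp τ with hZ
  set Fm : ℕ → ℝ → ℝ := fun L τ =>
    ∑ j ∈ Finset.Icc (-(L : ℤ)) L, (Wm j).toReal * (blockL2 (u τ) j ^ 2).toReal with hFm
  set Fp : ℕ → ℝ → ℝ := fun L τ =>
    ∑ j ∈ Finset.Icc (-(L : ℤ)) L, (Wp j).toReal * (blockL2 (u τ) j ^ 2).toReal with hFp
  set g : ℤ → ℝ → ℝ := fun j τ =>
    -ν * (∑ i, ∫ x, ‖fderiv ℝ (blockFn j (u τ)) x (stdOrthonormalBasis ℝ (EuclideanSpace ℝ (Fin 3)) i)‖ ^ 2) -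
      ∫ x, ⟪blockFn j (u τ) x, blockFn j (convect (u τ) (u τ)) x⟫ with hg
  have hsub : Icc s t ⊆ Ioo 0 T := fun τ hτ => ⟨hs.trans_le hτ.1, hτ.2.trans_lt htT⟩
  have hw : ∀ τ ∈ Icc s t, IsSmoothL2Field (u τ) := fun τ hτ =>
    isSmoothL2Field_slice_of_maximal hν hT hmax hLH (hsub hτ)
  have hdiv : ∀ τ ∈ Icc s t, VectorCalculus.IsDivFree (u τ) := fun τ hτ =>
    hmax.1.divFree τ ⟨(hsub hτ).1.le, (hsub hτ).2⟩
  have hWmtop : ∀ j, Wm j ≠ ∞ := fun j => RiccatiSlice.two_rpow_ne_top _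
  have hWptop : ∀ j, Wp j ≠ ∞ := fun j => RiccatiSlice.two_rpow_ne_top _
  have haj : ∀ τ ∈ Icc s t, ∀ j, blockL2 (u τ) j ^ 2 ≠ ∞ := fun τ hτ j =>
    ENNReal.pow_ne_top (((hw τ hτ).blockFn j).memLp_two).eLpNorm_ne_top
  have hymtop : ∀ τ ∈ Icc s t, ∑' j : ℤ, Wm j * blockL2 (u τ) j ^ 2 ≠ ∞ := fun τ hτ =>
    HighRows.row_ne_top (by linarith) hν hT hmax hLH (hsub hτ)
  have hyptop : ∀ τ ∈ Icc s t, ∑' j : ℤ, Wp j * blockL2 (u τ) j ^ 2 ≠ ∞ := fun τ hτ =>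
    HighRows.row_ne_top (by linarith) hν hT hmax hLH (hsub hτ)
  have hYmc : ContinuousOn Ym (Icc s t) := HighRows.continuousOn_row (by linarith) hν hT hmax hLH hs hst htT
  have hYpc : ContinuousOn Yp (Icc s t) := HighRows.continuousOn_row (by linarith) hν hT hmax hLH hs hst htT
  have hZc : ContinuousOn Z (Icc s t) := hYmc.add (continuousOn_const.mul hYpc)
  have hZ0 : ∀ τ, 0 ≤ Z τ := fun τ => by
    simp only [hZ, hYm, hYp]; positivity
  have hZpw : IntervalIntegrable (fun τ => Z τ ^ (3 / 2 : ℝ)) volume s t := by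
    refine ContinuousOn.intervalIntegrable ?_
    rw [uIcc_of_le hst]
    exact hZc.rpow_const fun τ _ => Or.inr (by norm_num)
  -- the block balances and their integrability
  have hgint : ∀ j, IntervalIntegrable (g j) volume s t := fun j => by
    obtain ⟨hN, hS, -⟩ := blockL2_sq_toReal_sub_eq hν hT hmax hLH hs hst htT j
    exact (hS.const_mul (-ν)).sub hN
  have hEq : ∀ j, (blockL2 (u t) j ^ 2).toReal - (blockL2 (u s) j ^ 2).toReal = 2 * ∫ τ in s..t, g j τ := fun j =>
    (blockL2_sq_toReal_sub_eq hν hT hmax hLH hs hst htT j).2.2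
  -- Step 1: the inequality at level `L`
  have hL : ∀ L : ℕ, (Fm L t + lam * Fp L t) - (Fm L s + lam * Fp L s) ≤
      2 * (K₁ * lam ^ (-(1 / 4 : ℝ)) * ∫ τ in s..t, Z τ ^ (3 / 2 : ℝ)) := by
    intro L
    set I : Finset ℤ := Finset.Icc (-(L : ℤ)) L with hI
    have hid : (Fm L t + lam * Fp L t) - (Fm L s + lam * Fp L s) =
        2 * ∫ τ in s..t, ∑ j ∈ I, ((Wm j).toReal + lam * (Wp j).toReal) * g j τ := by
      have e1 : ∀ τ, Fm L τ + lam * Fp L τ =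
          ∑ j ∈ I, ((Wm j).toReal + lam * (Wp j).toReal) * (blockL2 (u τ) j ^ 2).toReal := by
        intro τ
        simp only [hFm, hFp]
        rw [Finset.mul_sum, ← Finset.sum_add_distrib]
        exact Finset.sum_congr rfl fun j _ => by ring
      rw [e1, e1, ← Finset.sum_sub_distrib,
        intervalIntegral.integral_finsetSum fun j _ => (hgint j).const_mul _, Finset.mul_sum]
      refine Finset.sum_congr rfl fun j _ => ?_
      rw [← mul_sub, hEq j, intervalIntegral.integral_const_mul]
      ring
    have hint : IntervalIntegrable (fun τ => ∑ j ∈ I, ((Wm j).toReal + lam * (Wp j).toReal) * g j τ) volume s t :=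
      (IntervalIntegrable.sum I fun j _ => (hgint j).const_mul ((Wm j).toReal + lam * (Wp j).toReal)).congr
        fun τ _ => by simp only [Finset.sum_apply]
    have hint' : IntervalIntegrable (fun τ => K₁ * lam ^ (-(1 / 4 : ℝ)) * Z τ ^ (3 / 2 : ℝ)) volume s t :=
      hZpw.const_mul _
    have hbound : ∀ τ ∈ Icc s t, ∑ j ∈ I, ((Wm j).toReal + lam * (Wp j).toReal) * g j τ ≤
        K₁ * lam ^ (-(1 / 4 : ℝ)) * Z τ ^ (3 / 2 : ℝ) := fun τ hτ =>
      hslice ν hν.le lam hlam (u τ) (hw τ hτ) (hdiv τ hτ) (hymtop τ hτ) (hyptop τ hτ) I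
    have hmono := intervalIntegral.integral_mono_on hst hint hint' hbound
    rw [hid]
    rw [intervalIntegral.integral_const_mul] at hmono
    linarith
  -- Step 2: `L → ∞`
  have hlimF : ∀ τ ∈ Icc s t, Tendsto (fun L : ℕ => Fm L τ + lam * Fp L τ) atTop (𝓝 (Z τ)) := by
    intro τ hτ
    have h1 : ∀ L : ℕ, Fm L τ = (∑ j ∈ Finset.Icc (-(L : ℤ)) L, Wm j * blockL2 (u τ) j ^ 2).toReal := by
      intro L
      rw [ENNReal.toReal_sum fun j _ => ENNReal.mul_ne_top (hWmtop j) (haj τ hτ j)]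
      exact Finset.sum_congr rfl fun j _ => (ENNReal.toReal_mul).symm
    have h2 : ∀ L : ℕ, Fp L τ = (∑ j ∈ Finset.Icc (-(L : ℤ)) L, Wp j * blockL2 (u τ) j ^ 2).toReal := by
      intro L
      rw [ENNReal.toReal_sum fun j _ => ENNReal.mul_ne_top (hWptop j) (haj τ hτ j)]
      exact Finset.sum_congr rfl fun j _ => (ENNReal.toReal_mul).symm
    have hm : Tendsto (fun L : ℕ => Fm L τ) atTop (𝓝 (Ym τ)) := by
      simp_rw [h1]
      exact (ENNReal.tendsto_toReal (hymtop τ hτ)).comp (tendsto_sum_Icc_atTop _)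
    have hp : Tendsto (fun L : ℕ => Fp L τ) atTop (𝓝 (Yp τ)) := by
      simp_rw [h2]
      exact (ENNReal.tendsto_toReal (hyptop τ hτ)).comp (tendsto_sum_Icc_atTop _)
    exact hm.add (hp.const_mul lam)
  have hlim := le_of_tendsto_of_tendsto ((hlimF t ⟨hst, le_rfl⟩).sub (hlimF s ⟨le_rfl, hst⟩))
    tendsto_const_nhds (Eventually.of_forall hL)
  have e : 2 * (K₁ * lam ^ (-(1 / 4 : ℝ)) * ∫ τ in s..t, Z τ ^ (3 / 2 : ℝ)) =
      2 * K₁ * lam ^ (-(1 / 4 : ℝ)) * ∫ τ in s..t, Z τ ^ (3 / 2 : ℝ) := by ring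
  exact hlim.trans_eq e

end Summit.NavierStokesRegularity.FluidComputer.StraddleInequality

end
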